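import Literature.AlgebraicGeometry.Motives.FamiliesVHS
import HarnessLib

/-!
# Fibres of geometric VHS data are finite dimensional

`GeometricVHSData B f n i` (`Motives/FamiliesVHS`) identifies each rational fibre `V_s` of its local
system with `Hⁱ(𝒳_s)` computed in the Weil cohomology theory `B.W` of the Betti–Hodge datum `B`
(`fiberIso s : V_s ≃ₗ[ℚ] B.W.obj (fiberOver f s) i`), and the fibre `𝒳_s` is smooth projective of
dimension `n` (`isSmoothProjective_fiberOver`). Axiom (A) of a Weil cohomology theory (Kleiman 1968,
§1.2 (A): each `Hⁱ(X)` is finite dimensional for `X` smooth projective; field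
`WeilCohomology.finite_obj`) therefore makes every `V_s` finite dimensional — so the instance
hypotheses `[∀ s, Module.Finite ℚ (D.V.fiber s)]` carried by route statements over geometric VHS
data (`HodgeConjecture/PeriodDeficiency.DeficiencyBound`, `.QbarGenericIsHodgeGeneric`, and the
finiteness clause of `.ClassicalGeometricVHS`) are dischargeable: `fun s ↦ D.finite_fiber s`.

* `GeometricVHSData.finite_obj_fiberOver` — `Hⁱ(𝒳_s)` (in `B.W`) is finite dimensional.
* `GeometricVHSData.finite_fiber` — `V_s` is finite dimensional.
* `GeometricVHSData.finrank_fiber_eq` — `dim V_s = dim Hⁱ(𝒳_s)`.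

## References

* S. Kleiman, *Algebraic cycles and the Weil conjectures* (1968), §1.2 (A).
* P. Griffiths, *Periods of integrals on algebraic manifolds III*, Publ. Math. IHÉS 38 (1970), §1.
-/

noncomputable section

open CategoryTheory AlgebraicGeometry

namespace Literature.AlgebraicGeometry.Motives

namespace GeometricVHSData

variable {B : BettiHodgeData ℂ} {𝒳 S : SchemeOver ℂ} {f : 𝒳 ⟶ S} {n i : ℕ}

/-- `Hⁱ(𝒳_s)`, computed in the Weil cohomology theory `B.W`, is finite dimensional for every fibre
of the family underlying a geometric VHS datum (the fibre is smooth projective; Kleiman 1968,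
§1.2 (A)). [cite: Kleiman1968, §1.2 (A)] -/
theorem finite_obj_fiberOver (D : GeometricVHSData B f n i) (s : ComplexPoints S) :
    Module.Finite ℚ (B.W.obj (fiberOver f s) i) :=
  B.W.finite_obj (D.isSmoothProjective_fiberOver s) i

/-- **The rational fibres `V_s` of a geometric VHS datum are finite dimensional**: `V_s ≃ Hⁱ(𝒳_s)`
(`fiberIso`) and `Hⁱ(𝒳_s)` is finite dimensional by axiom (A) of `B.W` (Kleiman 1968, §1.2 (A);
Griffiths 1970, §1: the local system of a VHS has finite rank). [cite: Kleiman1968, §1.2 (A)] -/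
theorem finite_fiber (D : GeometricVHSData B f n i) (s : ComplexPoints S) :
    Module.Finite ℚ (D.V.fiber s) :=
  haveI := D.finite_obj_fiberOver s
  Module.Finite.equiv (D.fiberIso s).symm

/-- The rank of the fibre `V_s` is the `i`-th Betti number of `𝒳_s` (in `B.W`): `fiberIso s` is a
linear equivalence. [cite: Griffiths1970, §1] -/
theorem finrank_fiber_eq (D : GeometricVHSData B f n i) (s : ComplexPoints S) :
    Module.finrank ℚ (D.V.fiber s) = Module.finrank ℚ (B.W.obj (fiberOver f s) i) :=
  (D.fiberIso s).finrank_eq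

end GeometricVHSData

end Literature.AlgebraicGeometry.Motives

end
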